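import Summits.HodgeConjecture.CorCM.TwoGroupCyclicEightTimesTwoActionTable
import HarnessLib

/-!
# The table of `(C₈ × C₂)·2`, injective-word-map version (no unit / inverse identities as hypotheses)

COR-CM (cell `pub-hodgecm2`), binder seat b04 (gen 36), count-neutral own lane «Galois-CM-type classification».  KERNEL ONLY:
theorems; no definition, no named fact, no `sorry`.  Pure group theory for «case A» of the ORDER-`32` BASE programme (A7-JUNCTION
gen-36 addendum §F, family IA8): `|G| = 32`, `a` of order `8`, `u` an involution commuting with `a`, `u ∉ ⟨a⟩` (so
`A = ⟨a⟩ × ⟨u⟩ ≅ C₈ × C₂`), `x ∉ A` with `x a = a^μ x`, `x u = a⁴ u x` (the involution `u` has the two conjugates `u, u a⁴`) and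
`x² = a^σ u^τ`.  The word map `(i, j, k) ↦ aⁱ uʲ xᵏ` inverts to a table model `e : G ≃ ℤ/8 × 𝔽₂ × 𝔽₂` carrying the multiplication to
`(i,j,k)(i',j',k') = (i + μᵏ i' + 4kj' + kk'σ, j + j' + kk'τ, k + k')` (`exists_table_c8c2_action_inj`, superseding `exists_table_c8c2_action` of the previous file, whose unit / left-inverse hypotheses
are too expensive to decide uniformly in the parameters: here the word map is shown injective directly and the law is passed by its
four `(k,k')`-cases only; `exists_table_equiv_of_words_inj` is the generic recognition lemma).  The groups: census #14 (`D₄ ∘ C₈`,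
`μ = 1, 5`), #24, #46 and `M₃₂`-like members — `CorCM/GaloisThirtyTwoCyclicEightTimesTwoCertificates` decides their certificates.

## References

* [Rotman1995] J. J. Rotman, *An Introduction to the Theory of Groups*, 4th ed., GTM 148, Ch. 5 (extensions with cyclic kernel).
* [Shimura1998] G. Shimura, *Abelian Varieties with Complex Multiplication and Modular Functions*, §8.2.
-/

namespace Summit.HodgeConjecture.CorCM.GaloisModels.CyclicEightTimesTwo

open Summit.HodgeConjecture.CorCM.GaloisTableLaws

variable {G : Type*} [Group G]

/-! ## §1 Recognition from an injective multiplicative word map -/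

/-- **Recognition of a table from words, injective version**: `f : X → G` multiplicative and injective with `|G| = |X|`
⟹ a table model `e : G ≃ X` with `e (f p) = p`. [folklore] -/
theorem exists_table_equiv_of_words_inj {X : Type*} [Fintype X] [Finite G] (mul : X → X → X) (f : X → G)
    (hf : ∀ p q : X, f (mul p q) = f p * f q) (hinj : Function.Injective f) (hcard : Nat.card G = Fintype.card X) :
    ∃ e : G ≃ X, (∀ a b : G, e (a * b) = mul (e a) (e b)) ∧ ∀ p : X, e (f p) = p := by
  have hbij : Function.Bijective f :=
    hinj.bijective_of_nat_card_le (by rw [hcard, Nat.card_eq_fintype_card])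
  refine ⟨(Equiv.ofBijective f hbij).symm, fun a b => ?_, fun p => ?_⟩
  · obtain ⟨p, rfl⟩ := hbij.2 a
    obtain ⟨q, rfl⟩ := hbij.2 b
    rw [← hf]
    simp only [Equiv.ofBijective_symm_apply_apply]
  · simp only [Equiv.ofBijective_symm_apply_apply]

/-! ## §2 The table model -/

variable [Finite G]

/-- **Table model for `(C₈ × C₂)·2`, `θ(a) = a^μ`, `θ(u) = u a⁴`, `x² = a^σ u^τ`.**  `|G| = 32`, `orderOf a = 8`, `u² = 1`,
`u a = a u`, `u ∉ ⟨a⟩`, `x ≠ aⁱ uʲ`, `x a = a^μ x`, `x u = a⁴ u x`, `x x = a^σ u^τ`; `mul` an operation on `ℤ/8 × 𝔽₂ × 𝔽₂` given by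
its four `(k, k')`-cases.  Then `e : G ≃ ℤ/8 × 𝔽₂ × 𝔽₂` with `e(gh) = mul (e g) (e h)` and
`e (aⁱ uʲ xᵏ) = (i, j, k)`. [cite: Rotman1995, Ch. 5] -/
theorem exists_table_c8c2_action_inj {a u x : G} (μ σ : ZMod 8) (τ : ZMod 2) (ha : orderOf a = 8) (huu : u * u = 1)
    (hua : u * a = a * u) (hu : u ∉ Subgroup.zpowers a) (hx : ∀ i j : ℕ, x ≠ a ^ i * u ^ j)
    (hxa : x * a = a ^ μ.val * x) (hxu : x * u = a ^ 4 * u * x) (hxx : x * x = a ^ σ.val * u ^ τ.val)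
    (hcard : Nat.card G = 32)
    (mul : ZMod 8 × ZMod 2 × ZMod 2 → ZMod 8 × ZMod 2 × ZMod 2 → ZMod 8 × ZMod 2 × ZMod 2)
    (h00 : ∀ (i : ZMod 8) (j : ZMod 2) (i' : ZMod 8) (j' : ZMod 2), mul (i, j, 0) (i', j', 0) = (i + i', j + j', 0))
    (h01 : ∀ (i : ZMod 8) (j : ZMod 2) (i' : ZMod 8) (j' : ZMod 2), mul (i, j, 0) (i', j', 1) = (i + i', j + j', 1))
    (h10 : ∀ (i : ZMod 8) (j : ZMod 2) (i' : ZMod 8) (j' : ZMod 2),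
      mul (i, j, 1) (i', j', 0) = (i + μ * i' + 4 * (j'.val : ZMod 8), j + j', 1))
    (h11 : ∀ (i : ZMod 8) (j : ZMod 2) (i' : ZMod 8) (j' : ZMod 2),
      mul (i, j, 1) (i', j', 1) = (i + μ * i' + 4 * (j'.val : ZMod 8) + σ, j + j' + τ, 0))
 :
    ∃ e : G ≃ ZMod 8 × ZMod 2 × ZMod 2, (∀ g h : G, e (g * h) = mul (e g) (e h)) ∧
      ∀ p : ZMod 8 × ZMod 2 × ZMod 2, e (a ^ p.1.val * u ^ p.2.1.val * x ^ p.2.2.val) = p := by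
  have hv0 : (0 : ZMod 2).val = 0 := rfl
  have hv1 : (1 : ZMod 2).val = 1 := rfl
  have ha8 : a ^ 8 = 1 := by rw [← ha]; exact pow_orderOf_eq_one a
  have hapow : ∀ m n : ℕ, m % 8 = n % 8 → a ^ m = a ^ n := fun m n h => pow_eq_pow_of_mod_eq a ha8 h
  have hupow : ∀ m n : ℕ, m % 2 = n % 2 → u ^ m = u ^ n := fun m n h =>
    pow_eq_pow_of_mod_eq u (n := 2) (by rw [pow_two, huu]) h
  -- collection rules
  have XA : ∀ (n : ℕ) (R : G), x * (a ^ n * R) = a ^ (μ.val * n) * (x * R) := act_pow_tail hxa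
  have XA' : ∀ n : ℕ, x * a ^ n = a ^ (μ.val * n) * x := fun n => by
    have h := XA n 1; simp only [mul_one] at h; exact h
  have XU : ∀ (n : ℕ) (R : G), x * (u ^ n * R) = a ^ (4 * n) * (u ^ n * (x * R)) := act_invol_pow_tail hua hxu
  have XU' : ∀ n : ℕ, x * u ^ n = a ^ (4 * n) * (u ^ n * x) := fun n => by
    have h := XU n 1; simp only [mul_one] at h; exact h
  have UA : ∀ (m n : ℕ) (R : G), u ^ m * (a ^ n * R) = a ^ n * (u ^ m * R) := comm_pow_tail hua
  have UA' : ∀ m n : ℕ, u ^ m * a ^ n = a ^ n * u ^ m := fun m n => ((show Commute u a from hua).pow_pow m n).eq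
  have AA : ∀ (m n : ℕ) (R : G), a ^ m * (a ^ n * R) = a ^ (m + n) * R := fun m n R => by rw [← mul_assoc, ← pow_add]
  have AA' : ∀ m n : ℕ, a ^ m * a ^ n = a ^ (m + n) := fun m n => (pow_add a m n).symm
  have UU : ∀ (m n : ℕ) (R : G), u ^ m * (u ^ n * R) = u ^ (m + n) * R := fun m n R => by rw [← mul_assoc, ← pow_add]
  have UU' : ∀ m n : ℕ, u ^ m * u ^ n = u ^ (m + n) := fun m n => (pow_add u m n).symm
  -- values of sums in `ZMod 8` / `ZMod 2`
  have hvμ : ∀ i' : ZMod 8, (μ * i').val % 8 = μ.val * i'.val % 8 := fun i' => by rw [ZMod.val_mul]; exact Nat.mod_mod _ _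
  have hv4 : ∀ j' : ZMod 2, (4 * (j'.val : ZMod 8)).val % 8 = 4 * j'.val % 8 := fun j' => by
    rw [ZMod.val_mul, ZMod.val_natCast]
    have : (4 : ZMod 8).val = 4 := rfl
    rw [this]; simp [Nat.mul_mod]
  set f : ZMod 8 × ZMod 2 × ZMod 2 → G := fun p => a ^ p.1.val * u ^ p.2.1.val * x ^ p.2.2.val with hf_def
  have hf : ∀ p q, f (mul p q) = f p * f q := by
    rintro ⟨i, j, k⟩ ⟨i', j', k'⟩
    rcases zmod2_cases k with rfl | rfl <;> rcases zmod2_cases k' with rfl | rfl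
    · rw [h00]
      simp only [hf_def, hv0, pow_zero, mul_one]
      simp only [mul_assoc, UA, AA, UU']
      refine congrArg₂ (· * ·) (hapow _ _ ?_) (hupow _ _ ?_)
      · rw [ZMod.val_add]; omega
      · rw [ZMod.val_add]; omega
    · rw [h01]
      simp only [hf_def, hv0, hv1, pow_zero, pow_one, mul_one]
      simp only [mul_assoc, UA, AA, UU]
      refine congrArg₂ (· * ·) (hapow _ _ ?_) (congrArg₂ (· * ·) (hupow _ _ ?_) rfl)
      · rw [ZMod.val_add]; omega
      · rw [ZMod.val_add]; omega
    · rw [h10]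
      simp only [hf_def, hv0, hv1, pow_zero, pow_one, mul_one]
      simp only [mul_assoc, XA, XU', UA, AA, UU]
      refine congrArg₂ (· * ·) (hapow _ _ ?_) (congrArg₂ (· * ·) (hupow _ _ ?_) rfl)
      · have h1 := hvμ i'; have h2 := hv4 j'
        rw [ZMod.val_add, ZMod.val_add]
        generalize (μ * i').val = M at h1 ⊢; generalize μ.val * i'.val = M' at h1 ⊢
        generalize (4 * (j'.val : ZMod 8)).val = F at h2 ⊢
        omega
      · rw [ZMod.val_add]; omega
    · rw [h11]
      simp only [hf_def, hv0, hv1, pow_zero, pow_one, mul_one]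
      simp only [mul_assoc, XA, XU, UA, AA, UU', hxx]
      refine congrArg₂ (· * ·) (hapow _ _ ?_) (hupow _ _ ?_)
      · have h1 := hvμ i'; have h2 := hv4 j'
        rw [ZMod.val_add, ZMod.val_add, ZMod.val_add]
        generalize (μ * i').val = M at h1 ⊢; generalize μ.val * i'.val = M' at h1 ⊢
        generalize (4 * (j'.val : ZMod 8)).val = F at h2 ⊢
        omega
      · rw [ZMod.val_add, ZMod.val_add]; omega
  -- words with `k = 0` that are trivial
  have hker0 : ∀ (i : ZMod 8) (j : ZMod 2), a ^ i.val * u ^ j.val = 1 → i = 0 ∧ j = 0 := by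
    intro i j h
    rcases zmod2_cases j with rfl | rfl
    · rw [hv0, pow_zero, mul_one] at h
      have h8 : 8 ∣ i.val := by
        have := orderOf_dvd_of_pow_eq_one h
        rwa [ha] at this
      have hi : i = 0 := by
        have := ZMod.val_lt i
        have h0 : i.val = 0 := by omega
        exact (ZMod.val_eq_zero i).1 h0
      exact ⟨hi, rfl⟩
    · exfalso
      rw [hv1, pow_one] at h
      apply hu
      have hu' : u = a ^ (7 * i.val) := by
        have h2 : a ^ (7 * i.val) * (a ^ i.val * u) = a ^ (7 * i.val) := by rw [h, mul_one]
        rw [← mul_assoc, ← pow_add, hapow (7 * i.val + i.val) 0 (by omega), pow_zero, one_mul] at h2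
        exact h2
      rw [hu']
      exact Subgroup.pow_mem _ (Subgroup.mem_zpowers a) _
  -- `x` is not a word `aⁱ uʲ x⁰`: equality of words forces equal `k`
  have hAx : ∀ (i : ZMod 8) (j : ZMod 2) (i' : ZMod 8) (j' : ZMod 2),
      a ^ i.val * u ^ j.val ≠ a ^ i'.val * u ^ j'.val * x := by
    intro i j i' j' h
    apply hx (7 * i'.val + i.val) (j'.val + j.val)
    have h2 : a ^ (7 * i'.val) * u ^ j'.val * (a ^ i.val * u ^ j.val) =
        a ^ (7 * i'.val) * u ^ j'.val * (a ^ i'.val * u ^ j'.val * x) := by rw [h]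
    have lhs : a ^ (7 * i'.val) * u ^ j'.val * (a ^ i.val * u ^ j.val) = a ^ (7 * i'.val + i.val) * u ^ (j'.val + j.val) := by
      simp only [mul_assoc, UA, AA, UU']
    have rhs : a ^ (7 * i'.val) * u ^ j'.val * (a ^ i'.val * u ^ j'.val * x) = x := by
      simp only [mul_assoc, UA, AA, UU]
      rw [hapow (7 * i'.val + i'.val) 0 (by omega), hupow (j'.val + j'.val) 0 (by omega), pow_zero, pow_zero, one_mul,
        one_mul]
    rw [lhs, rhs] at h2
    exact h2.symm
  have hinj : Function.Injective f := by
    rintro ⟨i, j, k⟩ ⟨i', j', k'⟩ h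
    simp only [hf_def] at h
    -- equal `k`
    have hkk : k = k' := by
      rcases zmod2_cases k with rfl | rfl <;> rcases zmod2_cases k' with rfl | rfl
      · rfl
      · exfalso
        rw [hv0, hv1, pow_zero, pow_one, mul_one] at h
        exact hAx i j i' j' h
      · exfalso
        rw [hv0, hv1, pow_zero, pow_one, mul_one] at h
        exact hAx i' j' i j h.symm
      · rfl
    subst hkk
    have h' : a ^ i.val * u ^ j.val = a ^ i'.val * u ^ j'.val := mul_right_cancel h
    -- `a^{7i'+i} u^{j'+j} = 1`
    have h2 : a ^ (7 * i'.val) * u ^ j'.val * (a ^ i.val * u ^ j.val) = 1 := by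
      rw [h']
      simp only [mul_assoc, UA, AA, UU']
      rw [hapow (7 * i'.val + i'.val) 0 (by omega), hupow (j'.val + j'.val) 0 (by omega), pow_zero, pow_zero, one_mul]
    have h3 : a ^ (7 * i' + i).val * u ^ (j' + j).val = 1 := by
      rw [← h2]
      simp only [mul_assoc, UA, AA, UU']
      refine congrArg₂ (· * ·) (hapow _ _ ?_) (hupow _ _ ?_)
      · have : (7 * i').val % 8 = 7 * i'.val % 8 := by
          rw [ZMod.val_mul]; exact by simp [Nat.mul_mod, show (7 : ZMod 8).val = 7 from rfl]
        rw [ZMod.val_add]; generalize (7 * i').val = M at this ⊢; omega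
      · rw [ZMod.val_add]; omega
    obtain ⟨hi, hj⟩ := hker0 _ _ h3
    have hii : i = i' := by
      have h8 : (8 : ZMod 8) = 0 := by decide
      have : i = -(7 * i') := eq_neg_of_add_eq_zero_right hi
      rw [this]
      linear_combination (-i') * h8
    have hjj : j = j' := by
      have : j = -j' := eq_neg_of_add_eq_zero_right hj
      rw [this]
      rcases zmod2_cases j' with rfl | rfl <;> decide
    rw [hii, hjj]
  obtain ⟨e, he, hef⟩ := exists_table_equiv_of_words_inj mul f hf hinj (by rw [hcard]; simp [ZMod.card])
  exact ⟨e, he, fun p => hef p⟩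

end Summit.HodgeConjecture.CorCM.GaloisModels.CyclicEightTimesTwo
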